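import Mathlib
import Summits.Ventures.PercRepro2.TwoHullMasterBlockCheck
import Summits.Ventures.PercRepro2.TwoHullMasterKeyedTree

/-!
# A kernel checker for KEYED cube covers, and `K₄ − e` decorates (blind cell PercRepro2, night-4 g40,
2026-08-29; proofs/NIGHT4-G40.md §15″)

A key certificate of a block of `checkCover` is the coordinate `j` of its interface bit and three
vertex masks Before / At / After; `checkKey` verifies by computation the four membership facts of
`KeyedBlock` at every point of the block, the mirror of the pair of `l` at the antipode, and that
every vertex but `h` is classified; `checkKeyedCover` = `checkCover` + a key for every block.
**`hasKeyedCover_of_checkKeyedCover`** turns an accepted certificate into `HasKeyedCover … Set.univ`,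
so an explicit graph with a kernel-checked keyed cover is a `Decorated.base` — it decorates like a
path and composes in parallel like one (TwoHullMasterKeyedTree.lean).  The instance: `K₄ − e` with
`l, h` the two vertices of degree 2 (the first graph outside the theta graphs of decorated paths — a
chord between the inner vertices), one keyed block (**`hasKeyedCover_k4e`**, `decorated_k4e`,
`twoHullMaster_k4e`, `sw_k4e o`).
-/

namespace Summit.Ventures.PercRepro2

namespace BlockCheck

open Hull LocRows Path2 Glue2 Blocks SwCheck

variable {n : ℕ}

/-! ## §1 The key checks -/

/-- The key checks of one block `b` with the certificate `k = (j, bef, at, aft)`: the bit is the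
coordinate `j`; at every point, `bef` avoids the hull pair of `h`, `aft` avoids the hull pair of `l`,
`at` is not red for `l` / blue for `h` when the bit is clear and not blue for `l` / red for `h` when
the bit is set, and the antipode mirrors the pair of `l`; every vertex but `h` is classified. -/
def checkKey (es : List (Fin n × Fin n)) (l h : Fin n) (b : ℕ × List ℕ) (k : ℕ × ℕ × ℕ × ℕ) :
    Bool :=
  decide (k.1 < b.2.length) &&
  (List.range (2 ^ b.2.length)).all (fun s =>
    ((rMask es (ptMask b.1 b.2 s) h ||| bMask es (ptMask b.1 b.2 s) h) &&& k.2.1) == 0 &&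
    ((rMask es (ptMask b.1 b.2 s) l ||| bMask es (ptMask b.1 b.2 s) l) &&& k.2.2.2) == 0 &&
    (!(s.testBit k.1) ||
      ((bMask es (ptMask b.1 b.2 s) l ||| rMask es (ptMask b.1 b.2 s) h) &&& k.2.2.1) == 0) &&
    (s.testBit k.1 ||
      ((rMask es (ptMask b.1 b.2 s) l ||| bMask es (ptMask b.1 b.2 s) h) &&& k.2.2.1) == 0) &&
    mirrorEq es (ptMask b.1 b.2 s) (ptMask b.1 b.2 (blueMask b.2.length s)) l) &&
  subMask n ((2 ^ n - 1) ^^^ 2 ^ h.val) (k.2.1 ||| k.2.2.1 ||| k.2.2.2)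

/-- **The keyed checker**: the cover passes `checkCover` and every block has a key. -/
def checkKeyedCover (es : List (Fin n × Fin n)) (l h : Fin n) (blocks : List (ℕ × List ℕ))
    (keys : List (ℕ × ℕ × ℕ × ℕ)) : Bool :=
  checkCover es l h blocks && decide (keys.length = blocks.length) &&
  (List.range blocks.length).all (fun i =>
    checkKey es l h (blocks.getD i (0, [])) (keys.getD i (0, 0, 0, 0)))

/-! ## §2 What the key checks guarantee -/

/-- The vertices of a mask. -/
def maskSet (a : ℕ) : Set (Fin n) := {x | a.testBit x.val = true}

/-- The interface bit of a block: its coordinate `j` (`false` when `j` is out of range). -/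
def keyBit (d j : ℕ) (ε : Fin d → Bool) : Bool := if hj : j < d then ε ⟨j, hj⟩ else false

/-- The key bit is monotone. -/
lemma keyBit_mono {d j : ℕ} {ε ε' : Fin d → Bool} (hle : ε ≤ ε') :
    keyBit d j ε ≤ keyBit d j ε' := by
  unfold keyBit
  split_ifs with hj
  · exact hle ⟨j, hj⟩
  · exact le_rfl

/-- The key bit is negated at the antipode. -/
lemma keyBit_cubeNot {d j : ℕ} (hj : j < d) (ε : Fin d → Bool) :
    keyBit d j (cubeNot ε) = !keyBit d j ε := by
  simp [keyBit, hj, cubeNot]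

/-- The key bit is the bit `j` of the encoding. -/
lemma keyBit_eq_testBit {d j : ℕ} (hj : j < d) (ε : Fin d → Bool) :
    keyBit d j ε = (encode ε).testBit j := by
  simp [keyBit, hj, testBit_encode ε ⟨j, hj⟩]

/-- A zero `and` kills the bits of the first mask on the second. -/
lemma testBit_eq_false_of_land_eq_zero {A B : ℕ} (h : A &&& B = 0) {i : ℕ}
    (hB : B.testBit i = true) : A.testBit i = false := by
  have := congrArg (fun S => S.testBit i) h
  simpa [Nat.testBit_land, hB] using this

/-- A clear bit of an `or` is clear on both. -/
lemma testBit_or_eq_false {A B i : ℕ} (h : (A ||| B).testBit i = false) :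
    A.testBit i = false ∧ B.testBit i = false := by
  simpa [Nat.testBit_or] using h

variable (es : List (Fin n × Fin n)) (l h : Fin n) (blocks : List (ℕ × List ℕ))

/-- Membership in the red side of a hull pair of a point is a bit of `rMask`. -/
lemma mem_pt_fst_iff (b : Fin blocks.length) (ε : Fin (blocks.get b).2.length → Bool) (v x : Fin n) :
    x ∈ (hullPair (endsOf es) (pt es blocks b ε) v).1 ↔
      (rMask es (ptMask (blocks.get b).1 (blocks.get b).2 (encode ε)) v).testBit x.val = true :=
  (rMask_testBit_iff es _ v x).symm

/-- Membership in the blue side of a hull pair of a point is a bit of `bMask`. -/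
lemma mem_pt_snd_iff (b : Fin blocks.length) (ε : Fin (blocks.get b).2.length → Bool) (v x : Fin n) :
    x ∈ (hullPair (endsOf es) (pt es blocks b ε) v).2 ↔
      (bMask es (ptMask (blocks.get b).1 (blocks.get b).2 (encode ε)) v).testBit x.val = true :=
  (bMask_testBit_iff es _ v x).symm

/-- **A block with an accepted key is keyed.** -/
lemma keyedBlock_of_checkKey (b : Fin blocks.length) (k : ℕ × ℕ × ℕ × ℕ)
    (hblock : CubeBlock (endsOf es) l h (pt es blocks b))
    (hk : checkKey es l h (blocks.get b) k = true) :
    KeyedBlock (endsOf es) l h (pt es blocks b) (keyBit _ k.1) (maskSet k.2.1) (maskSet k.2.2.1)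
      (maskSet k.2.2.2) := by
  simp only [checkKey, Bool.and_eq_true, decide_eq_true_eq, List.all_eq_true, List.mem_range,
    beq_iff_eq, Bool.or_eq_true, Bool.not_eq_true'] at hk
  obtain ⟨⟨hj, hpts⟩, -⟩ := hk
  refine ⟨hblock, fun ε ε' hle => keyBit_mono hle, fun ε => keyBit_cubeNot hj ε, ?_, ?_, ?_, ?_,
    ?_, ?_⟩
  · intro x hx ε
    obtain ⟨⟨⟨⟨h1, -⟩, -⟩, -⟩, -⟩ := hpts _ (encode_spec ε).1
    have := testBit_or_eq_false (testBit_eq_false_of_land_eq_zero h1 hx)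
    rw [mem_pt_fst_iff, mem_pt_snd_iff, this.1, this.2]
    simp
  · intro x hx ε
    obtain ⟨⟨⟨⟨-, h2⟩, -⟩, -⟩, -⟩ := hpts _ (encode_spec ε).1
    have := testBit_or_eq_false (testBit_eq_false_of_land_eq_zero h2 hx)
    rw [mem_pt_fst_iff, mem_pt_snd_iff, this.1, this.2]
    simp
  · intro x hx ε hbit
    obtain ⟨⟨⟨⟨-, -⟩, -⟩, h4⟩, -⟩ := hpts _ (encode_spec ε).1
    rw [keyBit_eq_testBit hj] at hbit
    rcases h4 with h4 | h4
    · exact absurd hbit (by simp [h4])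
    · have := testBit_or_eq_false (testBit_eq_false_of_land_eq_zero h4 hx)
      rw [mem_pt_fst_iff, this.1]
      simp
  · intro x hx ε hbit
    obtain ⟨⟨⟨⟨-, -⟩, h3⟩, -⟩, -⟩ := hpts _ (encode_spec ε).1
    rw [keyBit_eq_testBit hj] at hbit
    rcases h3 with h3 | h3
    · exact absurd hbit (by simp [h3])
    · have := testBit_or_eq_false (testBit_eq_false_of_land_eq_zero h3 hx)
      rw [mem_pt_snd_iff, this.1]
      simp
  · intro x hx ε hbit
    obtain ⟨⟨⟨⟨-, -⟩, h3⟩, -⟩, -⟩ := hpts _ (encode_spec ε).1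
    rw [keyBit_eq_testBit hj] at hbit
    rcases h3 with h3 | h3
    · exact absurd hbit (by simp [h3])
    · have := testBit_or_eq_false (testBit_eq_false_of_land_eq_zero h3 hx)
      rw [mem_pt_fst_iff, this.2]
      simp
  · intro x hx ε hbit
    obtain ⟨⟨⟨⟨-, -⟩, -⟩, h4⟩, -⟩ := hpts _ (encode_spec ε).1
    rw [keyBit_eq_testBit hj] at hbit
    rcases h4 with h4 | h4
    · exact absurd hbit (by simp [h4])
    · have := testBit_or_eq_false (testBit_eq_false_of_land_eq_zero h4 hx)
      rw [mem_pt_snd_iff, this.2]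
      simp

/-- A cover accepted by `checkCover` is a cube cover (the cover of `twoHullMaster_of_checkCover`). -/
lemma cubeCover_of_checkCover (hc : checkCover es l h blocks = true) :
    CubeCover (endsOf es) l h (pt es blocks) := by
  simp only [checkCover, Bool.and_eq_true, List.all_eq_true, List.mem_range, Bool.or_eq_true,
    Bool.not_eq_true', List.any_eq_true, beq_iff_eq, beq_eq_false_iff_ne, decide_eq_true_eq] at hc
  obtain ⟨⟨hblocks, hcover⟩, hdist⟩ := hc
  have hdist' : ∀ (b b' : Fin blocks.length) (s s' : ℕ), s < 2 ^ (blocks.get b).2.length →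
      s' < 2 ^ (blocks.get b').2.length →
      ptMask (blocks.get b).1 (blocks.get b).2 s = ptMask (blocks.get b').1 (blocks.get b').2 s' →
      b = b' ∧ s = s' := by
    intro b b' s s' hs hs' heq
    have := hdist b.val b.isLt b'.val b'.isLt s (by rwa [getD_eq_get]) s' (by rwa [getD_eq_get])
    rw [getD_eq_get, getD_eq_get] at this
    rcases this with ⟨hbb', hss'⟩ | hne
    · exact ⟨Fin.ext hbb', hss'⟩
    · exact absurd heq hne
  refine ⟨?_, ?_, ?_⟩
  · intro b
    refine cubeBlock_of_checkBlock es l h blocks b (hblocks _ (List.get_mem _ _)) ?_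
    intro s hs s' hs' hne heq
    exact hne (hdist' b b s s' hs hs' heq).2
  · intro ζ hζ
    obtain ⟨ω, hω, rfl⟩ := exists_toConfig_eq es.length ζ
    have hU : inU es l h ω = true := (inU_iff es l h ω).2 hζ
    obtain ⟨bl, hbl, s, hs, hps⟩ := (hcover ω hω).resolve_left (by simp [hU])
    obtain ⟨b, rfl⟩ := List.mem_iff_get.1 hbl
    refine ⟨b, toConfig _ s, ?_⟩
    simp only [pt, encode_toConfig hs, hps]
  · intro b b' ε ε' heq
    have hlt : ∀ (b : Fin blocks.length) s,
        ptMask (blocks.get b).1 (blocks.get b).2 s < 2 ^ es.length := by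
      intro b s
      have hb := hblocks _ (List.get_mem blocks b)
      simp only [checkBlock, Bool.and_eq_true, decide_eq_true_eq, List.all_eq_true] at hb
      exact ptMask_lt hb.1.1.1.1 (fun c hc => hb.1.1.1.2 c hc) s
    have h1 := toConfig_inj (hlt b _) (hlt b' _) heq
    exact (hdist' b b' _ _ (encode_spec ε).1 (encode_spec ε').1 h1).1

/-- **A classified keyed cover from a certificate.** -/
theorem hasKeyedCover_of_checkKeyedCover (keys : List (ℕ × ℕ × ℕ × ℕ))
    (hc : checkKeyedCover es l h blocks keys = true) :
    HasKeyedCover (endsOf es) l h Set.univ := by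
  simp only [checkKeyedCover, Bool.and_eq_true, decide_eq_true_eq, List.all_eq_true,
    List.mem_range] at hc
  obtain ⟨⟨hcover, -⟩, hkeys⟩ := hc
  have hcov := cubeCover_of_checkCover es l h blocks hcover
  have hkey : ∀ b : Fin blocks.length,
      checkKey es l h (blocks.get b) (keys.getD b.val (0, 0, 0, 0)) = true := by
    intro b
    have := hkeys b.val b.isLt
    rwa [getD_eq_get] at this
  refine ⟨Fin blocks.length, inferInstance, fun b => Fin (blocks.get b).2.length,
    fun b => inferInstance, pt es blocks, fun b => keyBit _ (keys.getD b.val (0, 0, 0, 0)).1,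
    fun b => maskSet (keys.getD b.val (0, 0, 0, 0)).2.1,
    fun b => maskSet (keys.getD b.val (0, 0, 0, 0)).2.2.1,
    fun b => maskSet (keys.getD b.val (0, 0, 0, 0)).2.2.2,
    ⟨hcov, fun b => keyedBlock_of_checkKey es l h blocks b _ (hcov.block b) (hkey b)⟩, ?_,
    fun b => ⟨Set.subset_univ _, Set.subset_univ _, Set.subset_univ _⟩, ?_⟩
  · intro b ε
    have hk := hkey b
    simp only [checkKey, Bool.and_eq_true, decide_eq_true_eq, List.all_eq_true, List.mem_range,
      beq_iff_eq, Bool.or_eq_true, Bool.not_eq_true'] at hk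
    obtain ⟨⟨-, hpts⟩, -⟩ := hk
    have := mirrorEq_spec es (hpts _ (encode_spec ε).1).2
    simp only [pt, encode_cubeNot]
    exact this
  · intro b v _ hvh
    have hk := hkey b
    simp only [checkKey, Bool.and_eq_true, decide_eq_true_eq, List.all_eq_true, List.mem_range,
      beq_iff_eq, Bool.or_eq_true, Bool.not_eq_true'] at hk
    obtain ⟨-, hsub⟩ := hk
    have hne : (h.val = v.val) = False := eq_false fun e => hvh (Fin.ext e.symm)
    have hv : ((2 ^ n - 1) ^^^ 2 ^ h.val).testBit v.val = true := by
      simp [Nat.testBit_xor, Nat.testBit_two_pow_sub_one, v.isLt, hne]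
    have := subMask_spec hsub v hv
    simp only [Nat.testBit_or, Bool.or_eq_true] at this
    rcases this with (h1 | h2) | h3
    · exact Or.inl h1
    · exact Or.inr (Or.inl h2)
    · exact Or.inr (Or.inr h3)

/-! ## §3 `K₄ − e` decorates -/

/-- `K₄ − e`: the paths `0–1–3`, `0–2–3` and the chord `1–2`; `l = 0`, `h = 3`. -/
def k4eEdges : List (Fin 4 × Fin 4) := [(0, 1), (0, 2), (1, 2), (1, 3), (2, 3)]

/-- The one block of `U` (`|U| = 4`): both paths flip as one class, the chord is the second class. -/
def k4eBlocks : List (ℕ × List ℕ) := [(24, [27, 4])]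

/-- Its key: the bit is the path class; `0` before, the inner vertices `1, 2` at the key. -/
def k4eKeys : List (ℕ × ℕ × ℕ × ℕ) := [(0, 1, 6, 0)]

/-- The keyed checker accepts `K₄ − e` (kernel computation). -/
theorem checkKeyedCover_k4e : checkKeyedCover k4eEdges 0 3 k4eBlocks k4eKeys = true := by
  decide +kernel

/-- **`K₄ − e` has a classified keyed cover.** -/
theorem hasKeyedCover_k4e : HasKeyedCover (endsOf k4eEdges) 0 3 Set.univ :=
  hasKeyedCover_of_checkKeyedCover k4eEdges 0 3 k4eBlocks k4eKeys checkKeyedCover_k4e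

/-- `K₄ − e` is a decorated graph: pendants at `0, 1, 2` and parallel compositions apply. -/
theorem decorated_k4e : Decorated 0 3 (Fin k4eEdges.length) (endsOf k4eEdges) Set.univ :=
  Decorated.base hasKeyedCover_k4e (Set.mem_univ _) (Set.mem_univ _) (by decide)

/-- (MM) on `K₄ − e`. -/
theorem twoHullMaster_k4e : TwoHullMaster (endsOf k4eEdges) 0 3 :=
  twoHullMaster_decorated decorated_k4e

/-- Row (SW) on `K₄ − e` for every mark. -/
theorem sw_k4e (o : Fin 4) : Sw (endsOf k4eEdges) 0 3 o :=
  sw_of_twoHullMaster o twoHullMaster_k4e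

end BlockCheck

end Summit.Ventures.PercRepro2
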